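import Summits.CriticalPhenomena.SAWScalingLimit.Theorems.SAWDevelopingMapHexConjectureRootGrowth
import HarnessLib

/-!
# Crux `HexConjecture` (stmt-CriticalPhenomena-0808), line `root-locality-replaces-loewner`:
the conformal package WITH the growth of the boundary profile at the root
(stub `stub_conformalPackageGrowth`)

Landing target:
`Summits/CriticalPhenomena/SAWScalingLimit/Theorems/SAWDevelopingMapHexConjectureConformalPackageGrowth.lean`
(`--supports stmt-CriticalPhenomena-0808`; lead continuation prover-line-stmt-CriticalPhenomena-0808-c6-0).

`exists_conformalPackageGrowth` is the conformal package `exists_conformalPackage` of the floor-ratio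
restriction bootstrap (`…ObservableToSLERestrictionCocycleHelpersPackage`: half-plane maps
`Ψ = -1/φ⁻¹ : D → ℍ`, `Ψ' : D' → ℍ` normalised `a ↦ ∞`, `b ↦ 0`, continuous logarithms `L, L'` of their
derivatives with boundary limits `Lb, L'b` at `b` and `Ls, L's` at the floor points `a + t`, `0 < t < ρ₁`,
the modulus function `R` and its coalescence `R(t) → d^{5/8}`) with TWO MORE OUTPUTS needed by the c6
reshape of the line (growth of the floor-ratio profile at the root):
* the boundary profile `G(t) = exp ((5/8) Re (Ls - Lb)) = |Ψ'(a + t)/Ψ'(b)|^{5/8}`, recorded in the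
  floor-point clause, realised as `t ↦ exp ((5/8) Re (L̄(a + t) - Lb))` with `L̄ = extendFrom D L` the
  boundary extension of `L` (the floor limits `Ls` are its values, `extendFrom_eq`), hence CONTINUOUS on
  `(0, ρ₁)` (`continuousOn_extendFrom_floor`, limits at every floor point by
  `exists_tendsto_log_deriv_floorPoint`);
* a constant `κ > 0` with `κ t^{-5/4} ≤ G(t)` for `0 < t < ρ₁`: the simple pole of `Ψ` at the root gives
  `log κ₀ - 2 log t ≤ Re Ls` (`rootLogDerivGrowth`, sibling `…HexConjectureRootGrowth`), and
  `exp ((5/8)(log κ₀ - 2 log t - Re Lb)) = κ t^{-5/4}` with `κ = exp ((5/8)(log κ₀ - Re Lb))`.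
The proof is the landed proof of `exists_conformalPackage` with the radius `ρ₁` also taken below the
growth radius and the three new clauses appended.
-/

noncomputable section

open scoped Topology Real
open Filter Set Metric Complex Bornology Function
open Literature.Probability.RandomPlanarGeometry
open UpperHalfPlane (upperHalfPlaneSet isOpen_upperHalfPlaneSet)

namespace Summit.CriticalPhenomena.SAWScalingLimit.Theorems.HexConjecture.RootLocality

open Summit.CriticalPhenomena.SAWScalingLimit.Theorems.ObservableToSLE.FloorRatio

/-- **The conformal package of the bootstrap, with the growth of the boundary profile at the root.**
Half-plane maps `Ψ : D → ℍ`, `Ψ' : D' → ℍ` with `a ↦ ∞`, `b ↦ 0`, continuous logarithms `L, L'` of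
`Ψ', Ψ''` with boundary limits at `b` and at the floor points `a + t` (`0 < t < ρ₁`), flatness of `D'`
at `a, b` with radius `ρ₁`, the coalescence `R(t) → d^{5/8}` of the modulus function
`R(t) = exp((5/8)(Re(Ls - Lb) - Re(L's - L'b)))`, and the boundary profile
`G(t) = exp((5/8) Re(Ls - Lb))`, continuous on `(0, ρ₁)` with `κ t^{-5/4} ≤ G(t)`.  See the module
docstring. [cite: LawlerSchrammWerner2003Restriction, §2 (2.4) p. 7 and §2 p. 9, transposed] -/
theorem exists_conformalPackageGrowth (D D' : DobrushinDomain) (ρ : ℝ)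
    (φ : ConformalEquiv upperHalfPlaneSet D.carrier)
    (Φ : ConformalEquiv (upperHalfPlaneSet \ φ.pullbackHull D') upperHalfPlaneSet) (d : ℝ)
    (hρ : 0 < ρ)
    (hflat0 : D.carrier ∩ ball (D.pt 0) ρ = {z : ℂ | (D.pt 0).im < z.im} ∩ ball (D.pt 0) ρ)
    (hflat1 : D.carrier ∩ ball (D.pt 1) ρ = {z : ℂ | (D.pt 1).im < z.im} ∩ ball (D.pt 1) ρ)
    (hD' : D.IsHullSubdomain D') (hφ : D.IsChordalUniformizing φ)
    (hΦ : IsRestrictionMap (φ.pullbackHull D') Φ)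
    (hd : HasRestrictionDeriv (φ.pullbackHull D') Φ d) :
    ∃ (Ψ : ConformalEquiv D.carrier upperHalfPlaneSet) (L : ℂ → ℂ) (Lb : ℂ)
      (Ψ' : ConformalEquiv D'.carrier upperHalfPlaneSet) (L' : ℂ → ℂ) (L'b : ℂ) (ρ₁ : ℝ)
      (R G : ℝ → ℝ) (κ : ℝ), 0 < ρ₁ ∧ ρ₁ ≤ ρ ∧
      Tendsto (fun z => ‖Ψ z‖) (𝓝[D.carrier] (D.pt 0)) atTop ∧ Ψ.HasBoundaryValue (D.pt 1) 0 ∧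
      ContinuousOn L D.carrier ∧ (∀ z ∈ D.carrier, exp (L z) = deriv Ψ z) ∧
      Tendsto L (𝓝[D.carrier] (D.pt 1)) (𝓝 Lb) ∧
      Tendsto (fun z => ‖Ψ' z‖) (𝓝[D'.carrier] (D.pt 0)) atTop ∧ Ψ'.HasBoundaryValue (D.pt 1) 0 ∧
      ContinuousOn L' D'.carrier ∧ (∀ z ∈ D'.carrier, exp (L' z) = deriv Ψ' z) ∧
      Tendsto L' (𝓝[D'.carrier] (D.pt 1)) (𝓝 L'b) ∧
      D'.carrier ∩ ball (D.pt 0) ρ₁ = {z : ℂ | (D.pt 0).im < z.im} ∩ ball (D.pt 0) ρ₁ ∧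
      D'.carrier ∩ ball (D.pt 1) ρ₁ = {z : ℂ | (D.pt 1).im < z.im} ∩ ball (D.pt 1) ρ₁ ∧
      (∀ t : ℝ, 0 < t → t < ρ₁ →
        (D.pt 0 + t ∈ frontier D.carrier) ∧ (D.pt 0 + t ∈ frontier D'.carrier) ∧
        (D.pt 0 + (t : ℂ) ≠ D.pt 0) ∧
        ∃ Ls L's : ℂ, Tendsto L (𝓝[D.carrier] (D.pt 0 + t)) (𝓝 Ls) ∧
          Tendsto L' (𝓝[D'.carrier] (D.pt 0 + t)) (𝓝 L's) ∧
          Real.exp ((5 / 8) * ((Ls - Lb).re - (L's - L'b).re)) = R t ∧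
          Real.exp ((5 / 8) * (Ls - Lb).re) = G t) ∧
      Tendsto R (𝓝[>] 0) (𝓝 (d ^ ((5 : ℝ) / 8))) ∧
      0 < κ ∧ ContinuousOn G (Set.Ioo 0 ρ₁) ∧
      (∀ t : ℝ, 0 < t → t < ρ₁ → κ * t ^ (-(5 / 4 : ℝ)) ≤ G t) := by
  -- The landed proof of `exists_conformalPackage` (`…RestrictionCocycleHelpersPackage.lean`), with the
  -- additions for `G`, `κ` marked NEW.
  -- names
  set a₀ : ℂ := D.pt 0 with ha₀
  set b₀ : ℂ := D.pt 1 with hb₀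
  have hab : a₀ ≠ b₀ := fun h => absurd (D.pt_injective h) (by decide)
  have hdab : 0 < dist a₀ b₀ := dist_pos.2 hab
  have hsub : D'.carrier ⊆ D.carrier := hD'.carrier_subset
  -- the hull and its reflected restriction map
  have hA : IsStarHull (φ.pullbackHull D') :=
    IsStarHull.pullbackHull JordanDomain.isSimplyConnected_holds hφ hD'
  have hB : IsBoundedHull (φ.pullbackHull D') := hA.isBoundedHull
  have hd0 : 0 < d := by
    obtain ⟨d', hd'0, -, hd'⟩ := IsStarHull.exists_hasRestrictionDeriv_holds hA hΦ
    rwa [HasRestrictionDeriv.unique hA hd hd']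
  -- the half-plane maps and the logarithms
  obtain ⟨Ψ, hΨ, hΨinf, hΨb, hΨreal⟩ := exists_halfPlaneMap D φ hφ
  obtain ⟨L, hLc, hLe⟩ := exists_log_deriv D.toJordanDomain Ψ
  -- NEW (growth at the root): `log κ₀ - 2 log t ≤ Re Ls` for `0 < t < rg`
  obtain ⟨κ₀, hκ₀, rg, hrg, hgrowth⟩ := rootLogDerivGrowth D φ hφ hρ hflat0 Ψ hΨ hLe
  set φ' : ConformalEquiv upperHalfPlaneSet D'.carrier := Φ.symm.trans (φ.restrHull D' hsub) with hφ'
  have hφ'u : D'.IsChordalUniformizing φ' :=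
    MarkedDomain.IsChordalUniformizing.pullback JordanDomain.isSimplyConnected_holds
      exists_conformalEquiv_ball_holds JordanDomain.exists_continuousOn_extension_holds hφ hD' hΦ
  obtain ⟨Ψ', hΨ'₀, hΨ'inf, hΨ'b, hΨ'real⟩ := exists_halfPlaneMap D' φ' hφ'u
  have hΨ' : ∀ z, Ψ' z = -(Φ (φ.symm z))⁻¹ := fun z => by rw [hΨ'₀ z]; rfl
  obtain ⟨L', hL'c, hL'e⟩ := exists_log_deriv D'.toJordanDomain Ψ'
  rw [hD'.pt_zero_eq, ← ha₀] at hΨ'inf hΨ'real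
  rw [hD'.pt_one_eq, ← hb₀] at hΨ'b
  rw [← ha₀] at hΨinf hΨreal hgrowth
  rw [← hb₀] at hΨb
  -- radii: `D' = D` near `a₀` and `b₀`
  have hagree : ∀ p : ℂ, p ∉ closure (D.carrier \ D'.carrier) →
      ∃ r > 0, ∀ r' ≤ r, D'.carrier ∩ ball p r' = D.carrier ∩ ball p r' := by
    intro p hp
    obtain ⟨r, hr, hrs⟩ := Metric.mem_nhds_iff.1 (isClosed_closure.isOpen_compl.mem_nhds hp)
    refine ⟨r, hr, fun r' hr' => Set.ext fun z => ⟨fun h => ⟨hsub h.1, h.2⟩, fun h => ⟨?_, h.2⟩⟩⟩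
    by_contra h'
    exact hrs (ball_subset_ball hr' h.2) (subset_closure ⟨h.1, h'⟩)
  obtain ⟨ra, hra, hraD⟩ := hagree a₀ hD'.pt_zero_notMem
  obtain ⟨rb, hrb, hrbD⟩ := hagree b₀ hD'.pt_one_notMem
  -- `ρ₀`: the geometric radius
  set ρ₀ : ℝ := min (min ρ ra) (min rb (dist a₀ b₀)) / 2 with hρ₀
  have hρ₀pos : 0 < ρ₀ := by
    rw [hρ₀]; exact half_pos (lt_min (lt_min hρ hra) (lt_min hrb hdab))
  obtain ⟨hρ₀ρ, hρ₀a, hρ₀b, hρ₀d⟩ : 2 * ρ₀ ≤ ρ ∧ 2 * ρ₀ ≤ ra ∧ 2 * ρ₀ ≤ rb ∧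
      2 * ρ₀ ≤ dist a₀ b₀ := by
    rw [hρ₀]
    refine ⟨?_, ?_, ?_, ?_⟩ <;>
      linarith [min_le_left (min ρ ra) (min rb (dist a₀ b₀)), min_le_left ρ ra, min_le_right ρ ra,
        min_le_right (min ρ ra) (min rb (dist a₀ b₀)), min_le_left rb (dist a₀ b₀),
        min_le_right rb (dist a₀ b₀)]
  -- flatness of `D'` at `a₀` and `b₀` (radius `2ρ₀`)
  have hflat0' : D'.carrier ∩ ball a₀ (2 * ρ₀) = {z : ℂ | a₀.im < z.im} ∩ ball a₀ (2 * ρ₀) := by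
    rw [hraD _ hρ₀a]; exact flat_of_subset hflat0 (ball_subset_ball hρ₀ρ) rfl
  have hflat1' : D'.carrier ∩ ball b₀ (2 * ρ₀) = {z : ℂ | b₀.im < z.im} ∩ ball b₀ (2 * ρ₀) := by
    rw [hrbD _ hρ₀b]; exact flat_of_subset hflat1 (ball_subset_ball hρ₀ρ) rfl
  have hflatD : D.carrier ∩ ball a₀ (2 * ρ₀) = {z : ℂ | a₀.im < z.im} ∩ ball a₀ (2 * ρ₀) :=
    flat_of_subset hflat0 (ball_subset_ball hρ₀ρ) rfl
  -- the limits of `L`, `L'` at the points of the punctured diameter (sibling `…RootGrowth`)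
  have hLlim : ∀ t : ℝ, t ≠ 0 → |t| < 2 * ρ₀ →
      ∃ Ls : ℂ, Tendsto L (𝓝[D.carrier] (a₀ + t)) (𝓝 Ls) := fun t ht0 ht =>
    exists_tendsto_log_deriv_floorPoint Ψ hflatD hΨreal hLc hLe ht0 ht
  have hL'lim : ∀ t : ℝ, t ≠ 0 → |t| < 2 * ρ₀ →
      ∃ L's : ℂ, Tendsto L' (𝓝[D'.carrier] (a₀ + t)) (𝓝 L's) := fun t ht0 ht =>
    exists_tendsto_log_deriv_floorPoint Ψ' hflat0' hΨ'real hL'c hL'e ht0 ht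
  -- the boundary values `Q t` of `φ⁻¹` at the floor points `a₀ + t`
  have hfr : ∀ t : ℝ, |t| < 2 * ρ₀ → a₀ + t ∈ frontier D.carrier := fun t ht =>
    mem_frontier_of_flat hflat0 (ht.trans_le hρ₀ρ)
  have hfr' : ∀ t : ℝ, |t| < 2 * ρ₀ → a₀ + t ∈ frontier D'.carrier := fun t ht =>
    mem_frontier_of_flat hflat0' ht
  have hne_a : ∀ t : ℝ, t ≠ 0 → a₀ + (t : ℂ) ≠ a₀ := fun t ht h => ht (by
    have := congrArg Complex.re h; simpa using this)
  have hne_b : ∀ t : ℝ, |t| < 2 * ρ₀ → a₀ + (t : ℂ) ≠ b₀ := by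
    intro t ht h
    have : dist a₀ b₀ = |t| := by
      rw [← h, dist_eq_norm, show a₀ - (a₀ + t) = -(t : ℂ) by ring, norm_neg, norm_real,
        Real.norm_eq_abs]
    linarith
  have hq : ∀ t : ℝ, t ≠ 0 → |t| < 2 * ρ₀ → ∃ q : ℝ, q ≠ 0 ∧
      Tendsto φ.symm (𝓝[D.carrier] (a₀ + t)) (𝓝 (q : ℂ)) := fun t ht0 ht =>
    hφ.exists_tendsto_symm_of_mem_frontier (hfr t ht) (hne_a t ht0) (hne_b t ht)
  set Q : ℝ → ℂ := fun t => extendFrom D.carrier φ.symm (a₀ + t) with hQ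
  have hQt : ∀ t : ℝ, t ≠ 0 → |t| < 2 * ρ₀ → ∃ q : ℝ, q ≠ 0 ∧ Q t = q ∧
      Tendsto φ.symm (𝓝[D.carrier] (a₀ + t)) (𝓝 (q : ℂ)) := by
    intro t ht0 ht
    obtain ⟨q, hq0, hqt⟩ := hq t ht0 ht
    exact ⟨q, hq0, extendFrom_eq (frontier_subset_closure (hfr t ht)) hqt, hqt⟩
  have hQ0 : Tendsto Q (𝓝[>] 0) (𝓝 0) := by
    -- continuity of the extension along the floor segment
    set T : Set ℂ := (fun t : ℝ => a₀ + t) '' Ioo (-(2 * ρ₀)) (2 * ρ₀) with hT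
    have hTsub : T ⊆ closure D.carrier := by
      rintro _ ⟨t, ht, rfl⟩
      exact frontier_subset_closure (hfr t (abs_lt.2 ht))
    have hlim : ∀ z ∈ T, ∃ y, Tendsto φ.symm (𝓝[D.carrier] z) (𝓝 y) := by
      rintro _ ⟨t, ht, rfl⟩
      by_cases ht0 : t = 0
      · subst ht0
        refine ⟨0, ?_⟩
        have := hφ.tendsto_symm_nhds_zero
        simpa [ha₀] using this
      · obtain ⟨q, -, hqt⟩ := hq t ht0 (abs_lt.2 ht)
        exact ⟨q, hqt⟩
    have hcont : ContinuousOn (extendFrom D.carrier φ.symm) T := continuousOn_extendFrom hTsub hlim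
    have ha₀T : a₀ ∈ T := ⟨0, by simp [hρ₀pos], by simp⟩
    have hG0 : extendFrom D.carrier φ.symm a₀ = 0 := by
      refine extendFrom_eq (frontier_subset_closure (D.pt_mem_frontier 0)) ?_
      have := hφ.tendsto_symm_nhds_zero
      simpa [ha₀] using this
    have h1 : Tendsto (extendFrom D.carrier φ.symm) (𝓝[T] a₀) (𝓝 0) := by
      rw [← hG0]; exact hcont a₀ ha₀T
    have h2 : Tendsto (fun t : ℝ => a₀ + t) (𝓝[>] 0) (𝓝[T] a₀) := by
      refine tendsto_nhdsWithin_iff.2 ⟨?_, ?_⟩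
      · have : Continuous fun t : ℝ => a₀ + t := by fun_prop
        simpa using (this.tendsto 0).mono_left nhdsWithin_le_nhds
      · have hev : ∀ᶠ t : ℝ in 𝓝[>] 0, t < 2 * ρ₀ :=
          mem_nhdsWithin_of_mem_nhds (Iio_mem_nhds (by linarith))
        filter_upwards [hev, self_mem_nhdsWithin] with t ht ht0
        have ht0' : (0 : ℝ) < t := ht0
        exact ⟨t, ⟨by linarith, ht⟩, rfl⟩
    exact h1.comp h2
  -- `ε₁`: small nonzero points are good for `N`; `t₀`: for `0 < t < t₀`, `|Q t| < ε₁`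
  obtain ⟨ε₁, hε₁, hgood⟩ : ∃ ε₁ > 0, ∀ q : ℂ, q ≠ 0 → ‖q‖ < ε₁ →
      q ∈ symmDomain (φ.pullbackHull D') ∧ hullExt Φ q ≠ 0 := by
    obtain ⟨ε, hε, hεA⟩ : ∃ ε > 0, ball (0 : ℂ) ε ⊆ (φ.pullbackHull D')ᶜ :=
      Metric.mem_nhds_iff.1 (hB.isClosed.isOpen_compl.mem_nhds hA.zero_notMem)
    have hslope : Tendsto (fun w ↦ hullExt Φ w / w) (𝓝[≠] 0) (𝓝 (d : ℂ)) := by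
      refine ((hasDerivAt_iff_tendsto_slope.1 (hasDerivAt_hullExt_zero hA hΦ hd)).congr' ?_)
      filter_upwards [self_mem_nhdsWithin] with w hw
      rw [slope_def_field, hullExt_zero hA hΦ, sub_zero, sub_zero]
    have hev := hslope.eventually_ne (show (d : ℂ) ≠ 0 by exact_mod_cast hd0.ne')
    rw [eventually_nhdsWithin_iff, Metric.eventually_nhds_iff_ball] at hev
    obtain ⟨ε', hε', hε'E⟩ := hev
    refine ⟨min ε ε', lt_min hε hε', fun q hq0 hq => ⟨?_, fun h => ?_⟩⟩
    · have hdisj : Disjoint (ball ((0 : ℝ) : ℂ) ε) (φ.pullbackHull D') := by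
        rw [ofReal_zero]; exact subset_compl_iff_disjoint_right.1 hεA
      exact ball_subset_symmDomain hdisj (by
        rw [ofReal_zero, mem_ball_zero_iff]; exact hq.trans_le (min_le_left _ _))
    · exact hε'E q (mem_ball_zero_iff.2 (hq.trans_le (min_le_right _ _))) hq0 (by rw [h, zero_div])
  obtain ⟨t₀, ht₀, ht₀Q⟩ : ∃ t₀ > 0, ∀ t : ℝ, 0 < t → t < t₀ → ‖Q t‖ < ε₁ := by
    have hev : ∀ᶠ t in 𝓝[>] (0 : ℝ), ‖Q t‖ < ε₁ := by
      filter_upwards [hQ0 (Metric.ball_mem_nhds 0 hε₁)] with t ht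
      simpa using ht
    rw [eventually_nhdsWithin_iff, Metric.eventually_nhds_iff_ball] at hev
    obtain ⟨t₀, ht₀, h⟩ := hev
    refine ⟨t₀, ht₀, fun t ht ht' => h t ?_ ht⟩
    rw [mem_ball, Real.dist_eq, sub_zero, abs_of_pos ht]; exact ht'
  -- the final radius (NEW: also below the growth radius `rg`)
  set ρ₁ : ℝ := min (min ρ₀ t₀) rg with hρ₁
  have hρ₁pos : 0 < ρ₁ := lt_min (lt_min hρ₀pos ht₀) hrg
  have hρ₁ρ₀ : ρ₁ ≤ ρ₀ := (min_le_left _ _).trans (min_le_left _ _)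
  have hρ₁t₀ : ρ₁ ≤ t₀ := (min_le_left _ _).trans (min_le_right _ _)
  have hρ₁rg : ρ₁ ≤ rg := min_le_right _ _
  -- boundary limits at `b₀`
  have hne_b' : ∀ t : ℝ, |t| < ρ₀ → b₀ + (t : ℂ) ≠ a₀ := by
    intro t ht h
    have : dist a₀ b₀ = |t| := by
      rw [← h, dist_eq_norm, show b₀ + t - b₀ = (t : ℂ) by ring, norm_real, Real.norm_eq_abs]
    linarith
  have hbvb : ∀ t : ℝ, |t| < ρ₀ → ∃ σ : ℝ, Tendsto Ψ (𝓝[D.carrier] (b₀ + t)) (𝓝 (σ : ℂ)) :=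
    fun t ht => hΨreal _ (mem_frontier_of_flat hflat1 (by linarith)) (hne_b' t ht)
  have hbvb' : ∀ t : ℝ, |t| < ρ₀ → ∃ σ : ℝ, Tendsto Ψ' (𝓝[D'.carrier] (b₀ + t)) (𝓝 (σ : ℂ)) :=
    fun t ht => hΨ'real _ (mem_frontier_of_flat hflat1' (by linarith)) (hne_b' t ht)
  obtain ⟨Lb, hLb⟩ := exists_tendsto_log_deriv_of_flat Ψ hρ₀pos
    (flat_of_subset hflat1 (ball_subset_ball (by linarith)) rfl) hbvb hLc hLe
  obtain ⟨L'b, hL'b⟩ := exists_tendsto_log_deriv_of_flat Ψ' hρ₀pos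
    (flat_of_subset hflat1' (ball_subset_ball (by linarith)) rfl) hbvb' hL'c hL'e
  -- the key identity `exp (L' - L) = N ∘ φ⁻¹` on `D'`
  have hkey : ∀ z ∈ D'.carrier, exp (L' z - L z) =
      deriv (hullExt Φ) (φ.symm z) * (φ.symm z) ^ 2 / hullExt Φ (φ.symm z) ^ 2 := by
    intro z hz
    obtain ⟨hne, hder⟩ := deriv_halfPlaneMap_pullback hsub hB hΦ Ψ hΨ Ψ' hΨ' hz
    rw [exp_sub, hL'e z hz, hLe z (hsub hz), hder, mul_div_assoc, div_self hne, mul_one]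
  -- `exp (L'b - Lb) = 1`
  have hb1 : exp (L'b - Lb) = 1 := by
    refine exp_sub_eq_of_tendsto hsub (frontier_subset_closure ?_) hLb hL'b ?_ hkey
    · show D.pt 1 ∈ frontier D'.carrier
      rw [← hD'.pt_one_eq]; exact D'.pt_mem_frontier 1
    · have h1 : Tendsto φ.symm (𝓝[D'.carrier] b₀) (cocompact ℂ) :=
        hφ.tendsto_symm_cocompact.mono_left (nhdsWithin_mono _ hsub)
      exact (tendsto_derivRatio_cocompact hB hΦ).comp h1
  -- the modulus function
  set R : ℝ → ℝ := fun t => Real.exp ((5 / 8) *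
    -Real.log ‖deriv (hullExt Φ) (Q t) * (Q t) ^ 2 / hullExt Φ (Q t) ^ 2‖) with hR
  -- NEW: the boundary profile `G t = exp ((5/8) Re (L(a₀ + t) - Lb))` and its growth constant
  obtain ⟨Lx, hLx⟩ : ∃ Lx : ℝ → ℂ, ∀ t, Lx t = extendFrom D.carrier L (a₀ + t) :=
    ⟨_, fun t => rfl⟩
  obtain ⟨G, hG⟩ : ∃ G : ℝ → ℝ, ∀ t, G t = Real.exp ((5 / 8) * (Lx t - Lb).re) :=
    ⟨_, fun t => rfl⟩
  have hLxt : ∀ t : ℝ, 0 < t → t < ρ₁ → ∃ Ls : ℂ,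
      Tendsto L (𝓝[D.carrier] (a₀ + t)) (𝓝 Ls) ∧ Lx t = Ls := by
    intro t ht htρ
    have ht2 : |t| < 2 * ρ₀ := by rw [abs_of_pos ht]; linarith
    obtain ⟨Ls, hLs⟩ := hLlim t ht.ne' ht2
    exact ⟨Ls, hLs, (hLx t).trans (extendFrom_eq (frontier_subset_closure (hfr t ht2)) hLs)⟩
  have hGc : ContinuousOn G (Ioo 0 ρ₁) := by
    have hLxc : ContinuousOn Lx (Ioo 0 ρ₁) :=
      (continuousOn_extendFrom_floor (flat_of_subset hflat0 (ball_subset_ball (by linarith)) rfl)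
        fun t ht htρ => (hLxt t ht htρ).imp fun _ h => h.1).congr fun t _ => hLx t
    exact (continuousOn_const.mul (continuous_re.comp_continuousOn
      (hLxc.sub continuousOn_const))).rexp.congr fun t _ => hG t
  refine ⟨Ψ, L, Lb, Ψ', L', L'b, ρ₁, R, G, Real.exp ((5 / 8) * (Real.log κ₀ - Lb.re)), hρ₁pos,
    by linarith, hΨinf, hΨb, hLc, hLe, hLb, hΨ'inf, hΨ'b, hL'c, hL'e, hL'b,
    flat_of_subset hflat0' (ball_subset_ball (by linarith)) rfl,
    flat_of_subset hflat1' (ball_subset_ball (by linarith)) rfl, ?_, ?_, Real.exp_pos _, hGc, ?_⟩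
  · -- the floor points `s = a₀ + t`, `0 < t < ρ₁`
    intro t ht htρ
    have ht2 : |t| < 2 * ρ₀ := by rw [abs_of_pos ht]; linarith
    obtain ⟨q, hq0, hQq, hqt⟩ := hQt t ht.ne' ht2
    obtain ⟨Ls, hLs, hLxs⟩ := hLxt t ht htρ
    obtain ⟨L's, hL's⟩ := hL'lim t ht.ne' ht2
    refine ⟨hfr t ht2, hfr' t ht2, hne_a t ht.ne', Ls, L's, hLs, hL's, ?_, by rw [hG, hLxs]⟩
    -- `exp (L's - Ls) = N (Q t)`
    have hqgood := hgood (q : ℂ) (by exact_mod_cast hq0) (by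
      rw [← hQq]; exact ht₀Q t ht (htρ.trans_le hρ₁t₀))
    have hs1 : exp (L's - Ls) = deriv (hullExt Φ) q * (q : ℂ) ^ 2 / hullExt Φ q ^ 2 := by
      refine exp_sub_eq_of_tendsto hsub (frontier_subset_closure (hfr' t ht2)) hLs hL's ?_ hkey
      have h1 : Tendsto φ.symm (𝓝[D'.carrier] (a₀ + t)) (𝓝 (q : ℂ)) :=
        hqt.mono_left (nhdsWithin_mono _ hsub)
      exact (continuousAt_derivRatio hB hΦ hqgood.1 hqgood.2).tendsto.comp h1
    -- real parts
    have hre1 : (L'b - Lb).re = 0 := by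
      have := congrArg (fun w => Real.log ‖w‖) hb1
      simpa [Complex.norm_exp] using this
    have hre2 : (L's - Ls).re = Real.log ‖deriv (hullExt Φ) q * (q : ℂ) ^ 2 / hullExt Φ q ^ 2‖ := by
      rw [← hs1, Complex.norm_exp, Real.log_exp]
    rw [hR]
    simp only
    rw [hQq]
    congr 1
    have : (Ls - Lb).re - (L's - L'b).re = (L'b - Lb).re - (L's - Ls).re := by
      simp only [sub_re]; ring
    rw [this, hre1, hre2]
    ring
  · -- coalescence: `R t → d^{5/8}`
    have hQne : Tendsto Q (𝓝[>] 0) (𝓝[≠] 0) := by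
      refine tendsto_nhdsWithin_iff.2 ⟨hQ0, ?_⟩
      have hev : ∀ᶠ t : ℝ in 𝓝[>] 0, t < 2 * ρ₀ :=
        mem_nhdsWithin_of_mem_nhds (Iio_mem_nhds (by linarith))
      filter_upwards [hev, self_mem_nhdsWithin] with t ht ht0
      have ht0' : 0 < t := ht0
      obtain ⟨q, hq0, hQq, -⟩ := hQt t ht0'.ne' (by rw [abs_of_pos ht0']; exact ht)
      rw [hQq]
      show (q : ℂ) ≠ 0
      exact_mod_cast hq0
    have hN : Tendsto (fun t => deriv (hullExt Φ) (Q t) * (Q t) ^ 2 / hullExt Φ (Q t) ^ 2)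
        (𝓝[>] 0) (𝓝 ((d : ℂ)⁻¹)) := (tendsto_derivRatio_zero hA hΦ hd hd0).comp hQne
    have hnorm : Tendsto (fun t => ‖deriv (hullExt Φ) (Q t) * (Q t) ^ 2 / hullExt Φ (Q t) ^ 2‖)
        (𝓝[>] 0) (𝓝 d⁻¹) := by
      have := (continuous_norm.tendsto _).comp hN
      rwa [norm_inv, norm_real, Real.norm_of_nonneg hd0.le] at this
    have hlog := (Real.continuousAt_log (inv_ne_zero hd0.ne')).tendsto.comp hnorm
    rw [Function.comp_def, Real.log_inv] at hlog
    have hexp := (Real.continuous_exp.tendsto _).comp ((hlog.neg).const_mul (5 / 8))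
    rw [neg_neg] at hexp
    have hval : Real.exp ((5 / 8) * Real.log d) = d ^ ((5 : ℝ) / 8) := by
      rw [Real.rpow_def_of_pos hd0, mul_comm]
    rw [hval] at hexp
    exact hexp
  · -- NEW: growth `κ t^{-5/4} ≤ G t` for `0 < t < ρ₁`
    intro t ht htρ
    obtain ⟨Ls, hLs, hLxs⟩ := hLxt t ht htρ
    rw [hG, hLxs, sub_re]
    exact exp_growth_rpow ht (hgrowth t ht (htρ.trans_le hρ₁rg) Ls hLs)

/-! ### Registered form -/

/-- **Registered sub-goal `stub_conformalPackageGrowth`** (crux item stmt-CriticalPhenomena-0808,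
line `root-locality-replaces-loewner`, lead continuation c6): the conformal package with the boundary
profile `G` and its growth `κ t^{-5/4} ≤ G t` at the root (`exists_conformalPackageGrowth`), signature
fully qualified. [cite: LawlerSchrammWerner2003Restriction, §2 (2.4) p. 7 and §2 p. 9, transposed] -/
theorem stub_conformalPackageGrowth : ∀ (D D' : Literature.Probability.RandomPlanarGeometry.DobrushinDomain) (ρ : ℝ) (φ : Literature.Probability.RandomPlanarGeometry.ConformalEquiv UpperHalfPlane.upperHalfPlaneSet D.carrier) (Φ : Literature.Probability.RandomPlanarGeometry.ConformalEquiv (UpperHalfPlane.upperHalfPlaneSet \ φ.pullbackHull D') UpperHalfPlane.upperHalfPlaneSet) (d : ℝ), 0 < ρ → D.carrier ∩ Metric.ball (D.pt 0) ρ = {z : ℂ | (D.pt 0).im < z.im} ∩ Metric.ball (D.pt 0) ρ → D.carrier ∩ Metric.ball (D.pt 1) ρ = {z : ℂ | (D.pt 1).im < z.im} ∩ Metric.ball (D.pt 1) ρ → D.IsHullSubdomain D' → D.IsChordalUniformizing φ → Literature.Probability.RandomPlanarGeometry.IsRestrictionMap (φ.pullbackHull D') Φ → Literature.Probability.RandomPlanarGeometry.HasRestrictionDeriv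 (φ.pullbackHull D') Φ d → ∃ (Ψ : Literature.Probability.RandomPlanarGeometry.ConformalEquiv D.carrier UpperHalfPlane.upperHalfPlaneSet) (L : ℂ → ℂ) (Lb : ℂ) (Ψ' : Literature.Probability.RandomPlanarGeometry.ConformalEquiv D'.carrier UpperHalfPlane.upperHalfPlaneSet) (L' : ℂ → ℂ) (L'b : ℂ) (ρ₁ : ℝ) (R G : ℝ → ℝ) (κ : ℝ), 0 < ρ₁ ∧ ρ₁ ≤ ρ ∧ Filter.Tendsto (fun z => ‖Ψ z‖) (nhdsWithin (D.pt 0) D.carrier) Filter.atTop ∧ Ψ.HasBoundaryValue (D.pt 1) 0 ∧ ContinuousOn L D.carrier ∧ (∀ z ∈ D.carrier, Complex.exp (L z) = deriv Ψ z) ∧ Filter.Tendsto L (nhdsWithin (D.pt 1) D.carrier) (nhds Lb) ∧ Filter.Tendsto (fun z => ‖Ψ' z‖) (nhdsWithin (D.pt 0) D'.carrier) Filter.atTop ∧ Ψ'.HasBoundaryValue (D.pt 1) 0 ∧ ContinuousOn L' D'.carrier ∧ (∀ z ∈ D'.carrier, Complex.exp (L' z) = deriv Ψ' z) ∧ Filter.Tendsto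 L' (nhdsWithin (D.pt 1) D'.carrier) (nhds L'b) ∧ D'.carrier ∩ Metric.ball (D.pt 0) ρ₁ = {z : ℂ | (D.pt 0).im < z.im} ∩ Metric.ball (D.pt 0) ρ₁ ∧ D'.carrier ∩ Metric.ball (D.pt 1) ρ₁ = {z : ℂ | (D.pt 1).im < z.im} ∩ Metric.ball (D.pt 1) ρ₁ ∧ (∀ t : ℝ, 0 < t → t < ρ₁ → (D.pt 0 + t ∈ frontier D.carrier) ∧ (D.pt 0 + t ∈ frontier D'.carrier) ∧ (D.pt 0 + (t : ℂ) ≠ D.pt 0) ∧ ∃ Ls L's : ℂ, Filter.Tendsto L (nhdsWithin (D.pt 0 + t) D.carrier) (nhds Ls) ∧ Filter.Tendsto L' (nhdsWithin (D.pt 0 + t) D'.carrier) (nhds L's) ∧ Real.exp ((5 / 8) * ((Ls - Lb).re - (L's - L'b).re)) = R t ∧ Real.exp ((5 / 8) * (Ls - Lb).re) = G t) ∧ Filter.Tendsto R (nhdsWithin 0 (Set.Ioi 0)) (nhds (d ^ ((5 : ℝ) / 8))) ∧ 0 < κ ∧ ContinuousOn G (Set.Ioo 0 ρ₁) ∧ (∀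 t : ℝ, 0 < t → t < ρ₁ → κ * t ^ (-(5 / 4 : ℝ)) ≤ G t) :=
  fun D D' ρ φ Φ d hρ hflat0 hflat1 hD' hφ hΦ hd =>
    exists_conformalPackageGrowth D D' ρ φ Φ d hρ hflat0 hflat1 hD' hφ hΦ hd

end Summit.CriticalPhenomena.SAWScalingLimit.Theorems.HexConjecture.RootLocality

end
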